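import Summits.BirchSwinnertonDyer.BirchSwinnertonDyer.Theses.ByReductionTypeAtTwo
import Summits.BirchSwinnertonDyer.BirchSwinnertonDyer.Theorems.ByReductionTypeAtTwoSupersingularKuriharaOtsuki
import Summits.BirchSwinnertonDyer.Rank1Residual.X5.TwoAdicInstancesToolkit
import Summits.BirchSwinnertonDyer.Rank1Residual.Supersingular.FrobeniusTraceTwoParity
import Summits.BirchSwinnertonDyer.Rank1Residual.Additive.IntModelTamagawaCertificate
import Literature.NumberTheory.EllipticCurves.ComplexMultiplicationTwistIsogenyProofs
import Literature.NumberTheory.EllipticCurves.ComplexMultiplicationRationalJIntegralProofs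
import HarnessLib

/-!
# Route `ByReductionTypeAtTwo` (rung K4), crux `SupersingularRankZeroAtTwo` (item
# stmt-BirchSwinnertonDyer-19097): an INSTANCE RUNG beyond conductor `5000` — `BSD(5021a1, 2)` from
# PUBLISHED facts (Kurihara–Otsuki 2006, Gross–Zagier–Kolyvagin) and ONE `L`-value certificate
# (seat `bsd-2adic-ss-1`)

HONEST FRAMING (cell `bsd-2adic`, run/shared/lean/pub/bsd-2adic/, HUMAN RULINGS D-0036/D-0059/D-0074):
THEOREMS ONLY; nothing booked; BSD is NOT proved by any of this. PARTITION (D-0054): X5@2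
good-SUPERSINGULAR (B1·O1) × p = 2 — an instance rung for the crux (tribunal judge, K4 round 3,
2026-08-26T04:57:55Z, note (c): "one supersingular-at-2 instance rung with N > 5000 for 19097"); it
closes NO residue class (the 757 rank-`0` residue classes all have `2⁴ ∣ #Ш_an`; this curve has
`#Ш_an = 1` and is covered in print — it is a RUNG, a kernel-checked member of the crux's class beyond
the range `N < 5000` where BSD is verified numerically, Creutz–Miller / Miller 2011).

THE CURVE. Cremona `5021a1` = `[0, 1, 1, −4, −1]`: `y² + y = x³ + x² − 4x − 1`, `Δ = 5021` (prime),
`c₄ = 208`, `j = 208³/5021` (not integral ⇒ no CM), conductor `N = 5021 > 5000` (prime; split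
multiplicative `I₁` at `5021`, node-tangent root `w = 1371`), good SUPERSINGULAR at `2` with
`#Ẽ(𝔽₂) = 1`, i.e. `a₂ = +2`; Cremona's `allbsd`: rank `0`, `#E(ℚ)_tors = 1`, `∏ c_ℓ = 1`,
`#Ш_an = 1`, `L(E,1)/Ω_E = 1`. All of: ellipticity, global minimality (`gcd(Δ, c₄) = 1`), the
conductor, good reduction at `2`, `a₂ = 2`, no CM, and `2 ∤ ∏ c_ℓ` (Tate's algorithm row certificate,
rank-2 observatory format `TamLocal`, split `I₁` at `5021`) are DECIDED BY THE KERNEL below.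

THE THEOREM `bsdp_two_5021a1`: `BSD(5021a1, 2)` (Miller's `BSDp W 2`) from the tree's named PUBLISHED
facts `kuriharaOtsuki_selmer_trivial_supersingular_two` (Kurihara–Otsuki, PAMQ 2 (2006) Thm. 0.1 (2):
`a₂ = ±2`, `ord₂(L(E,1)/Ω_E) = ord₂ Tam(E) = 0 ⇒ Sel_{2^∞}(E/ℚ) = 0`) and
`rank_eq_analyticRank_of_analyticRank_le_one` (GZK), through the landed door
`Theorems.bsdp_two_of_kuriharaOtsuki` (p421511), modulo ONE displayed CERTIFICATE binder
`hL1 : L(E,1)/Ω_E = 1` (exact rational special value; Cremona `allbsd` row `5021 a 1`; kit job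
j250945, PARI 2.15.4, evidence attached on the item: modular symbol `[0]⁺ = 2 = L(E,1)/ω₁` exactly,
`c_∞ = 2`, so `L(E,1)/Ω_E = 1`; 60-digit `ellL1/E.omega` agree; the same job re-checks `N = Δ = 5021`
prime, Kodaira `I₁` split at `5021` with `c = 1`, `a₂ = +2`, `a₅₀₂₁ = +1`, `#tors = 1`, root number
`+1`, `ellanalyticrank = 0`, and a `2`-descent `ellrank = [0, 0, 0, []]`, i.e. `Ш(E)[2] = 0`
independently of Kurihara–Otsuki). `supersingularRankZeroAtTwo_at_5021a1`
restates it in the crux's binder shape (`¬ HasCM → analyticRank = 0 → GoodSS W 2 → BSDp W 2`).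

References: [KuriharaOtsuki2006] Thm. 0.1 (2); [CremonaAlgorithms1997] Table 1; [SilvermanAEC2009]
VII.1 Rem. 1.1, VII.5 Prop. 5.1, App. C §11; [Silverman1994] IV.9.4; [Miller2011LMS] Def. 1.1, §1.
-/

set_option autoImplicit false
-- the Theorems namespace of this sub repeats the summit name by design (D-0017 nested layout)
set_option linter.dupNamespace false

noncomputable section

open scoped Classical

open WeierstrassCurve Literature.NumberTheory.EllipticCurves
  Literature.NumberTheory.EllipticCurves.Rank1Residual Literature.NumberTheory.EllipticCurves.Rank1Residual.Typed
  Summit.BirchSwinnertonDyer.Rank1Residual Summit.BirchSwinnertonDyer.Rank1Residual.Supersingular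
  Summit.BirchSwinnertonDyer.Rank1Residual.X5.Instances
  Summit.BirchSwinnertonDyer.BirchSwinnertonDyer.Rank2Observatory.Tam
  Summit.BirchSwinnertonDyer.Rank1Residual.Additive.IntModelTam

namespace Summit.BirchSwinnertonDyer.BirchSwinnertonDyer.Theorems

/-! ## §1 The model and its kernel-decided invariants -/

/-! The curve is written LITERALLY throughout (no abbreviation is declared, so that this file stays a
pure-proof file): `M = ⟨0, 1, 1, −4, −1⟩ : WeierstrassCurve ℤ` (Cremona `5021a1`) and `E = M ⊗ ℚ`. -/

/-- `Δ(5021a1) = 5021` (a prime). [cite: CremonaAlgorithms1997, Table 1] -/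
theorem M5021a1_Δ : (⟨0, 1, 1, -4, -1⟩ : WeierstrassCurve ℤ).Δ = 5021 := by decide

/-- `c₄(5021a1) = 208 = 2⁴·13`. [cite: CremonaAlgorithms1997, Table 1] -/
theorem M5021a1_c₄ : (⟨0, 1, 1, -4, -1⟩ : WeierstrassCurve ℤ).c₄ = 208 := by decide

/-- `5021a1` is an elliptic curve (`Δ = 5021 ≠ 0`). [cite: CremonaAlgorithms1997, Table 1] -/
theorem isElliptic_5021a1 : ((⟨0, 1, 1, -4, -1⟩ : WeierstrassCurve ℤ).baseChange ℚ).IsElliptic := by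
  rw [WeierstrassCurve.isElliptic_iff, baseChange_int_Δ, M5021a1_Δ]; norm_num

/-- Cremona's model `5021a1` is globally minimal (`gcd(Δ, c₄) = 1`). [cite: SilvermanAEC2009, VII.1 Remark 1.1] -/
theorem isGloballyMinimal_5021a1 : ((⟨0, 1, 1, -4, -1⟩ : WeierstrassCurve ℤ).baseChange ℚ).IsGloballyMinimal :=
  isGloballyMinimal_baseChange_int_of_gcd_eq_one 0 1 1 (-4) (-1) (by decide)

/-! The two instance facts are THEOREMS (no `instance` is declared in this pure-proof file); statements
below that need them take them as instance binders, proofs install them with `haveI`. -/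

/-- `Δ(5021a1)` and `c₄(5021a1)` are coprime (semistable model). [cite: SilvermanAEC2009, VII.5 Prop. 5.1(b)] -/
theorem M5021a1_coprime : IsCoprime (⟨0, 1, 1, -4, -1⟩ : WeierstrassCurve ℤ).Δ (⟨0, 1, 1, -4, -1⟩ : WeierstrassCurve ℤ).c₄ := by
  rw [M5021a1_Δ, M5021a1_c₄, Int.isCoprime_iff_gcd_eq_one]; decide

/-- **The conductor of `5021a1` is the prime `5021 > 5000`** (semistable: `N = rad Δ`).
[cite: Silverman1994, IV.10.2 (a),(b)] -/
theorem conductorNorm_5021a1 [((⟨0, 1, 1, -4, -1⟩ : WeierstrassCurve ℤ).baseChange ℚ).IsElliptic] :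
    ((⟨0, 1, 1, -4, -1⟩ : WeierstrassCurve ℤ).baseChange ℚ).conductorNorm ℤ = 5021 := by
  refine conductorNorm_baseChange_int_of_isCoprime (⟨0, 1, 1, -4, -1⟩ : WeierstrassCurve ℤ) M5021a1_coprime (k := 1) ?_ ?_ ?_
  · exact (show Nat.Prime 5021 by norm_num).prime.squarefree
  · rw [M5021a1_Δ]; norm_num
  · rw [M5021a1_Δ]; norm_num

/-- `5000 < N(5021a1)`: the rung lies beyond the numerically verified range `N < 5000`.
[cite: Miller2011LMS, §1] -/
theorem conductorNorm_5021a1_gt [((⟨0, 1, 1, -4, -1⟩ : WeierstrassCurve ℤ).baseChange ℚ).IsElliptic] :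
    5000 < ((⟨0, 1, 1, -4, -1⟩ : WeierstrassCurve ℤ).baseChange ℚ).conductorNorm ℤ := by
  rw [conductorNorm_5021a1]; norm_num

/-- **Good reduction at `2`** (`2 ∤ Δ = 5021`). [cite: SilvermanAEC2009, VII.5 Prop. 5.1(a)] -/
theorem good_two_5021a1 : ((⟨0, 1, 1, -4, -1⟩ : WeierstrassCurve ℤ).baseChange ℚ).HasGoodReductionAtPrime 2 := by
  haveI := isGloballyMinimal_5021a1
  exact hasGoodReductionAtPrime_of_not_dvd _ 2 (by
    rw [Literature.NumberTheory.EllipticCurves.minimalDiscriminantInt_baseChange_int, M5021a1_Δ]; decide)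

/-- `#Ẽ(𝔽₂) = 1` for `5021a1`: the reduction `y² + y = x³ + x² + 1` has no affine point over `𝔽₂`
(normal form `a₁ = 0`, `a₃ = 1` with `a₂ + a₄ = 1`, `a₆ = 1`). [cite: SilvermanAEC2009, V.2 and App. A Prop. 1.1 (c)] -/
theorem card_F2_5021a1 : Nat.card ((⟨0, 1, 1, -4, -1⟩ : WeierstrassCurve ℤ).map (Int.castRingHom (ZMod 2))).toAffine.Point = 1 := by
  rw [natCard_point_F2_of_a₁_eq_zero_of_a₃_eq_one _ (by decide) (by decide)]
  decide

/-- **`a₂(5021a1) = +2`** (`= 3 − #Ẽ(𝔽₂)`): good SUPERSINGULAR reduction at `2`, trace `+2`.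
[cite: SilvermanAEC2009, V.2] -/
theorem frobeniusTrace_two_5021a1 [((⟨0, 1, 1, -4, -1⟩ : WeierstrassCurve ℤ).baseChange ℚ).IsGloballyMinimal] :
    ((⟨0, 1, 1, -4, -1⟩ : WeierstrassCurve ℤ).baseChange ℚ).frobeniusTrace 2 = 2 := by
  rw [frobeniusTrace_two_baseChange_int (⟨0, 1, 1, -4, -1⟩ : WeierstrassCurve ℤ) card_F2_5021a1]; norm_num

/-- `5021a1` is good supersingular at `2` (`GoodSS`: good reduction and `2 ∣ a₂ = 2`).
[cite: SilvermanAEC2009, V.2] -/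
theorem goodSS_two_5021a1 [((⟨0, 1, 1, -4, -1⟩ : WeierstrassCurve ℤ).baseChange ℚ).IsGloballyMinimal] :
    GoodSS ((⟨0, 1, 1, -4, -1⟩ : WeierstrassCurve ℤ).baseChange ℚ) 2 :=
  ⟨good_two_5021a1, by rw [frobeniusTrace_two_5021a1]; norm_num⟩

/-- **`5021a1` has no complex multiplication**: `j = 208³/5021` is not an integer, whereas a CM curve
over `ℚ` has integral `j` (tree theorem `exists_intCast_eq_j_of_hasCM`). [cite: SilvermanAEC2009, App. C §11] -/
theorem not_hasCM_5021a1 [((⟨0, 1, 1, -4, -1⟩ : WeierstrassCurve ℤ).baseChange ℚ).IsElliptic] :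
    ¬ ((⟨0, 1, 1, -4, -1⟩ : WeierstrassCurve ℤ).baseChange ℚ).HasCM := fun hCM ↦ by
  obtain ⟨n, hn⟩ := ((⟨0, 1, 1, -4, -1⟩ : WeierstrassCurve ℤ).baseChange ℚ).exists_intCast_eq_j_of_hasCM hCM
  rw [j_eq_c₄_pow_div, baseChange_int_c₄, baseChange_int_Δ, M5021a1_c₄, M5021a1_Δ] at hn
  have h : (n : ℚ) * 5021 = 208 ^ 3 := by
    rw [hn]; push_cast; field_simp
  have h' : n * 5021 = 208 ^ 3 := by exact_mod_cast h
  omega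

/-- Tate's algorithm ROW CERTIFICATE of `5021a1` (rank-2 observatory format `TamLocal`) checks on the
integer model (kernel decision): the one bad prime `5021` (`⌊√5021⌋ = 70`) is SPLIT multiplicative of
type `I₁` (node-tangent root `w = 1371`), `c₅₀₂₁ = 1`. [cite: Silverman1994, IV.9.4 Step 2] -/
theorem tamRowCheck_5021a1 :
    TamLocal.rowCheck [⟨5021, 70, 1, 1371, 0, 0, 0, 1, 0, 0, 1⟩] (⟨0, 1, 1, -4, -1⟩ : WeierstrassCurve ℤ) = true := by
  decide +kernel

/-- **`2 ∤ ∏ c_ℓ(5021a1)`** (indeed `∏ c_ℓ = c₅₀₂₁ = 1`), from the row certificate.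
[cite: Silverman1994, IV.9.4 Step 2] -/
theorem not_two_dvd_tamagawaProduct_5021a1 : ¬ 2 ∣ ((⟨0, 1, 1, -4, -1⟩ : WeierstrassCurve ℤ).baseChange ℚ).tamagawaProduct := by
  haveI := isGloballyMinimal_5021a1
  exact not_dvd_tamagawaProduct_of_intModel_of_rowCheck
    (Literature.NumberTheory.EllipticCurves.integralModelInt_baseChange_int (⟨0, 1, 1, -4, -1⟩ : WeierstrassCurve ℤ))
    tamRowCheck_5021a1 2 (by decide)

/-! ## §2 `BSD(5021a1, 2)` — the rung -/

/-- **`BSD(5021a1, 2)` — an instance RUNG of the crux `SupersingularRankZeroAtTwo` beyond conductor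
`5000`.** PUBLISHED inputs, by name: Kurihara–Otsuki 2006 Thm. 0.1 (2) (`hKO`, tree named fact) and
Gross–Zagier–Kolyvagin (`hGZK`). CERTIFICATE binder (the only one): `hL1 : L(E,1)/Ω_E = 1` — the
exact special value of Cremona's row `5021 a 1` (`Ω_E` = `realPeriodRat` of the minimal model; kit job
j250945: modular symbol `[0]⁺ = 2 = L(E,1)/ω₁`, `c_∞ = 2`, and `ellL1/E.omega` to 60 digits). Kernel-decided: minimality, `Δ`, good supersingular
reduction at `2` with `a₂ = +2`, and `2 ∤ ∏ c_ℓ` (Tate row certificate). Door: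
`Theorems.bsdp_two_of_kuriharaOtsuki` (`Sel_{2^∞}(E/ℚ) = 0` + GZK ⇒ `ord₂ #Ш = 0 = ord₂ #Ш_an`).
Closes no residue class; a rung, not a booking. [cite: KuriharaOtsuki2006, Thm. 0.1 (2) (p. 558)]
[cite: CremonaAlgorithms1997, Table 1] [cite: Miller2011LMS, Def. 1.1] -/
theorem bsdp_two_5021a1 (hKO : kuriharaOtsuki_selmer_trivial_supersingular_two)
    (hGZK : rank_eq_analyticRank_of_analyticRank_le_one)
    (hL1 : ((⟨0, 1, 1, -4, -1⟩ : WeierstrassCurve ℤ).baseChange ℚ).entireLFunction 1 / (((⟨0, 1, 1, -4, -1⟩ : WeierstrassCurve ℤ).baseChange ℚ).realPeriodRat : ℂ) = ((1 : ℚ) : ℂ)) :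
    BSDp ((⟨0, 1, 1, -4, -1⟩ : WeierstrassCurve ℤ).baseChange ℚ) 2 := by
  haveI := isElliptic_5021a1
  haveI := isGloballyMinimal_5021a1
  exact bsdp_two_of_kuriharaOtsuki _ hKO hGZK good_two_5021a1 (Or.inl frobeniusTrace_two_5021a1) hL1
    one_ne_zero (by simp) not_two_dvd_tamagawaProduct_5021a1

/-- **The rung in the crux's binder shape**: for `W = 5021a1` the body of
`Theses.ByReductionTypeAtTwo.SupersingularRankZeroAtTwo` (`¬ HasCM → analyticRank = 0 → GoodSS W 2 →
BSDp W 2`) holds granted {Kurihara–Otsuki, GZK} and the `L`-value certificate — all three antecedents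
being moreover TRUE here (`not_hasCM_5021a1`, `goodSS_two_5021a1`; `analyticRank = 0` from
`L(E,1)/Ω_E = 1 ≠ 0`). [cite: KuriharaOtsuki2006, Thm. 0.1 (2) (p. 558)] [cite: Miller2011LMS, Def. 1.1] -/
theorem supersingularRankZeroAtTwo_at_5021a1 [((⟨0, 1, 1, -4, -1⟩ : WeierstrassCurve ℤ).baseChange ℚ).IsElliptic]
    [((⟨0, 1, 1, -4, -1⟩ : WeierstrassCurve ℤ).baseChange ℚ).IsGloballyMinimal]
    (hKO : kuriharaOtsuki_selmer_trivial_supersingular_two)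
    (hGZK : rank_eq_analyticRank_of_analyticRank_le_one)
    (hL1 : ((⟨0, 1, 1, -4, -1⟩ : WeierstrassCurve ℤ).baseChange ℚ).entireLFunction 1 / (((⟨0, 1, 1, -4, -1⟩ : WeierstrassCurve ℤ).baseChange ℚ).realPeriodRat : ℂ) = ((1 : ℚ) : ℂ)) :
    ¬ ((⟨0, 1, 1, -4, -1⟩ : WeierstrassCurve ℤ).baseChange ℚ).HasCM → ((⟨0, 1, 1, -4, -1⟩ : WeierstrassCurve ℤ).baseChange ℚ).analyticRank = 0 → GoodSS ((⟨0, 1, 1, -4, -1⟩ : WeierstrassCurve ℤ).baseChange ℚ) 2 → BSDp ((⟨0, 1, 1, -4, -1⟩ : WeierstrassCurve ℤ).baseChange ℚ) 2 :=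
  fun _ _ _ ↦ bsdp_two_5021a1 hKO hGZK hL1

/-- The analytic rank of `5021a1` is `0`, granted the certificate `L(E,1)/Ω_E = 1` (so `L(E,1) ≠ 0`).
[cite: CremonaAlgorithms1997, Table 1] -/
theorem analyticRank_5021a1 (hL1 : ((⟨0, 1, 1, -4, -1⟩ : WeierstrassCurve ℤ).baseChange ℚ).entireLFunction 1 / (((⟨0, 1, 1, -4, -1⟩ : WeierstrassCurve ℤ).baseChange ℚ).realPeriodRat : ℂ) = ((1 : ℚ) : ℂ)) :
    ((⟨0, 1, 1, -4, -1⟩ : WeierstrassCurve ℤ).baseChange ℚ).analyticRank = 0 := by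
  refine analyticRank_eq_zero_of_entireLFunction_one_ne_zero ((⟨0, 1, 1, -4, -1⟩ : WeierstrassCurve ℤ).baseChange ℚ) fun h0 ↦ ?_
  rw [h0, zero_div] at hL1
  exact one_ne_zero (by exact_mod_cast hL1.symm : (1 : ℚ) = 0)

end Summit.BirchSwinnertonDyer.BirchSwinnertonDyer.Theorems

end
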